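import Summits.Langlands.Langlands.Theses.SenNullAlignment
import HarnessLib

/-!
# Birth skeleton (BC3) for the piece `WeakGeometricAutomorphy` of the BC2 redirect of
# `SenNullAlignment.SectorComplement` (stmt-Langlands-16308) — line `birth_WeakGeometricAutomorphy`

The piece is B_w (Fontaine–Mazur Conj. 1 + Langlands, a.e. form; VERBATIM the shared item stmt-Langlands-17414).  It is cut
along the mechanism every known case of (B) follows — POTENTIAL automorphy, then DESCENT:
* `stub_potentialWeakAutomorphy` (OPEN; theorem-level for regular, odd/polarisable, residually adequate ρ over CM /
  totally real K — Barnet-Lamb–Gee–Geraghty–Taylor 2014 Thm C, ACC+ 2023 §6; nothing for irregular weights or general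
  K): every irreducible pinned-geometric ρ becomes Satake–Frobenius compatible with an L-algebraic cuspidal π_L after
  restriction to SOME finite Galois extension L/K (the tree's `FramedGaloisRep.restrictField`);
* `stub_galoisDescentWeak` (OPEN — descent of automorphy along an arbitrary finite Galois layer; known along cyclic
  layers of prime degree for GL_n given cuspidality/invariance (Arthur–Clozel Ch. 3 Thm 6.2) and in the solvable
  residually-dihedral-free GL₂ cases; non-solvable descent is open): weak automorphy of ρ|_L for L/K finite Galois
  descends to weak automorphy of the irreducible geometric ρ over K.
`WeakGeometricAutomorphy_of` is modus ponens through the field L produced by the first stub (both stubs substantive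
and open; neither is B_w: the first lacks descent, the second lacks a potentially automorphic input).

Shape (for `ledger skeleton check`): named stubs `theorem stub_<name> : <Prop> := by sorry` (the ONLY sorries),
`_Goal.stub_<name> : Prop := type_of% @stub_<name>`, and `WeakGeometricAutomorphy_of (h₁ : _Goal.stub_…) … : WeakGeometricAutomorphy` concluding
the piece BY NAME (real proof); the last `example` feeds the stubs to it.  PRE-SPLIT VERSION: the piece is not yet a
decl of the route file, so it is declared here, VERBATIM the text filed in children.json, inside the route namespace;
after `route edit --split` lands it, delete section `0` and this file refers to the route decl unchanged.
-/

noncomputable section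

set_option linter.dupNamespace false

/-! ## 0. The piece, verbatim (pre-split stand-in for the route decl) -/

namespace Summit.Langlands.Langlands.Theses.SenNullAlignment

open scoped BigOperators Topology Manifold Classical MeasureTheory ProbabilityTheory Matrix InnerProductSpace ComplexConjugate ContinuousMap
open Filter Set Function TopologicalSpace MeasureTheory

/-- **P2 — B_w, weak automorphy of irreducible geometric Galois representations** (verbatim stmt-Langlands-17414) (children.json text, verbatim). -/
def WeakGeometricAutomorphy : Prop :=
  ∀ (K : Type) [Field K] [NumberField K] (n : ℕ) (hcpt : Literature.NumberTheory.Automorphic.isCompact_glFiniteIntegralLevel n K), 0 < n → ∀ (ℓ : ℕ) [Fact ℓ.Prime] (ι : PadicAlgCl ℓ ≃+* ℂ) (ρ : Literature.NumberTheory.GaloisRepresentations.FramedGaloisRep K (PadicAlgCl ℓ) n), ρ.toGaloisRep.IsIrreducible → ((∀ᶠ v : IsDedekindDomain.HeightOneSpectrum (NumberField.RingOfIntegers K) in cofinite, ρ.IsUnramifiedAt v) ∧ ∀ (v : IsDedekindDomain.HeightOneSpectrum (NumberField.RingOfIntegers K)) (hv : ((ℓ : ℕ) : NumberField.RingOfIntegers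 K) ∈ v.asIdeal), (Literature.NumberTheory.PAdicHodge.fontainePstAdicCompletion v ℓ hv).IsDeRhamFramed (ρ.toLocal v)) → ∃ π : Literature.NumberTheory.Automorphic.CuspidalAutomorphicRepData n K hcpt, π.1.IsLAlgebraic ∧ ∀ᶠ v : IsDedekindDomain.HeightOneSpectrum (NumberField.RingOfIntegers K) in cofinite, SatakeFrobCompatibleAt ι π.1 ρ v

end Summit.Langlands.Langlands.Theses.SenNullAlignment

namespace Summit.Langlands.Langlands.Cruxes.WeakGeometricAutomorphy.Birth

open scoped MatrixGroups Matrix Classical Polynomial NumberField BigOperators Topology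
open Filter IsDedekindDomain
open Literature.NumberTheory.Automorphic Literature.NumberTheory.GaloisRepresentations
open Summit.Langlands
open Summit.Langlands.Langlands.Theses.SenNullAlignment (WeakGeometricAutomorphy)

/-! ## 1. The stubs (the ONLY sorries of this file) -/

/-- **stub PWA — potential weak automorphy** (Taylor 2002; Barnet-Lamb–Gee–Geraghty–Taylor 2014 Thm C for regular,
odd, residually adequate ρ; OPEN in general): every irreducible pinned-geometric `ρ : Γ_K → GL_n(ℚ̄_ℓ)` is, after
restriction to some finite Galois extension `L/K`, Satake–Frobenius compatible a.e. with an L-algebraic cuspidal `π_L` of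
`GL_n(𝔸_L)`. [cite: BarnetlambEtAl2014, Thm. C] [cite: TaylorFM2002, Thm. A] -/
theorem stub_potentialWeakAutomorphy : ∀ (K : Type) [Field K] [NumberField K] (n : ℕ), 0 < n → ∀ (ℓ : ℕ) [Fact ℓ.Prime] (ι : PadicAlgCl ℓ ≃+* ℂ) (ρ : Literature.NumberTheory.GaloisRepresentations.FramedGaloisRep K (PadicAlgCl ℓ) n), ρ.toGaloisRep.IsIrreducible → ((∀ᶠ v : IsDedekindDomain.HeightOneSpectrum (NumberField.RingOfIntegers K) in Filter.cofinite, ρ.IsUnramifiedAt v) ∧ ∀ (v : IsDedekindDomain.HeightOneSpectrum (NumberField.RingOfIntegers K)) (hv : ((ℓ : ℕ) : NumberField.RingOfIntegers K) ∈ v.asIdeal), (Literature.NumberTheory.PAdicHodge.fontainePstAdicCompletion v ℓ hv).IsDeRhamFramed (ρ.toLocal v)) → ∃ (L : Type) (_ : Field L) (_ : NumberField L) (_ : Algebra K L), IsGalois K L ∧ ∃ (hcptL : Literature.NumberTheory.Automorphic.isCompact_glFiniteIntegralLevel n L) (πL : Literature.NumberTheory.Automorphic.CuspidalAutomorphicRepData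 n L hcptL), πL.1.IsLAlgebraic ∧ ∀ᶠ w : IsDedekindDomain.HeightOneSpectrum (NumberField.RingOfIntegers L) in Filter.cofinite, Summit.Langlands.SatakeFrobCompatibleAt ι πL.1 (ρ.restrictField L) w := by
  sorry

/-- **stub GD — Galois descent of weak automorphy for irreducible geometric representations** (OPEN for non-solvable
layers; cyclic prime layers: Arthur–Clozel Ch. 3 Thm 6.2 given cuspidality; solvable GL₂ cases: Langlands 1980):
if `ρ` is irreducible pinned-geometric over `K` and `ρ|_L` is Satake–Frobenius compatible a.e. with an L-algebraic
cuspidal `π_L` for some finite Galois `L/K`, then `ρ` is Satake–Frobenius compatible a.e. with an L-algebraic cuspidal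
`π` of `GL_n(𝔸_K)`. [cite: ArthurClozelAMS120, Ch. 3 Thm. 6.2] [cite: LanglandsBaseChange1980, §3] -/
theorem stub_galoisDescentWeak : ∀ (K : Type) [Field K] [NumberField K] (n : ℕ) (hcpt : Literature.NumberTheory.Automorphic.isCompact_glFiniteIntegralLevel n K), 0 < n → ∀ (ℓ : ℕ) [Fact ℓ.Prime] (ι : PadicAlgCl ℓ ≃+* ℂ) (ρ : Literature.NumberTheory.GaloisRepresentations.FramedGaloisRep K (PadicAlgCl ℓ) n), ρ.toGaloisRep.IsIrreducible → ((∀ᶠ v : IsDedekindDomain.HeightOneSpectrum (NumberField.RingOfIntegers K) in Filter.cofinite, ρ.IsUnramifiedAt v) ∧ ∀ (v : IsDedekindDomain.HeightOneSpectrum (NumberField.RingOfIntegers K)) (hv : ((ℓ : ℕ) : NumberField.RingOfIntegers K) ∈ v.asIdeal), (Literature.NumberTheory.PAdicHodge.fontainePstAdicCompletion v ℓ hv).IsDeRhamFramed (ρ.toLocal v)) → ∀ (L : Type) [Field L] [NumberField L] [Algebra K L], IsGalois K L → ∀ (hcptL : Literature.NumberTheory.Automorphic.isCompact_glFiniteIntegralLevel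 n L) (πL : Literature.NumberTheory.Automorphic.CuspidalAutomorphicRepData n L hcptL), πL.1.IsLAlgebraic → (∀ᶠ w : IsDedekindDomain.HeightOneSpectrum (NumberField.RingOfIntegers L) in Filter.cofinite, Summit.Langlands.SatakeFrobCompatibleAt ι πL.1 (ρ.restrictField L) w) → ∃ π : Literature.NumberTheory.Automorphic.CuspidalAutomorphicRepData n K hcpt, π.1.IsLAlgebraic ∧ ∀ᶠ v : IsDedekindDomain.HeightOneSpectrum (NumberField.RingOfIntegers K) in Filter.cofinite, Summit.Langlands.SatakeFrobCompatibleAt ι π.1 ρ v := by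
  sorry

/-! ## 2. The stub statements as named propositions -/

namespace _Goal

/-- The statement of `stub_potentialWeakAutomorphy` (literally its type). [folklore] -/
def stub_potentialWeakAutomorphy : Prop :=
  type_of% @Summit.Langlands.Langlands.Cruxes.WeakGeometricAutomorphy.Birth.stub_potentialWeakAutomorphy

/-- The statement of `stub_galoisDescentWeak` (literally its type). [folklore] -/
def stub_galoisDescentWeak : Prop :=
  type_of% @Summit.Langlands.Langlands.Cruxes.WeakGeometricAutomorphy.Birth.stub_galoisDescentWeak

end _Goal

/-! ## 3. The composition (kernel-checked, no `sorry`) -/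

/-- **`WeakGeometricAutomorphy` from potential automorphy and Galois descent** (modus ponens through the field
`L` and the cuspidal `π_L` produced by PWA; the local instances of `L` travel with the witness). -/
theorem WeakGeometricAutomorphy_of (hP : _Goal.stub_potentialWeakAutomorphy) (hD : _Goal.stub_galoisDescentWeak) : WeakGeometricAutomorphy := by
  dsimp only [_Goal.stub_potentialWeakAutomorphy, _Goal.stub_galoisDescentWeak] at hP hD
  intro K _ _ n hcpt hn ℓ _ ι ρ hirr hgeo
  obtain ⟨L, _instF, _instNF, _instA, hGal, hcptL, πL, hLalgL, hsatL⟩ := hP K n hn ℓ ι ρ hirr hgeo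
  exact hD K n hcpt hn ℓ ι ρ hirr hgeo L hGal hcptL πL hLalgL hsatL

/-- By-name sanity check: the stubs feed the composition as they stand. -/
example : WeakGeometricAutomorphy :=
  WeakGeometricAutomorphy_of stub_potentialWeakAutomorphy stub_galoisDescentWeak

end Summit.Langlands.Langlands.Cruxes.WeakGeometricAutomorphy.Birth

end
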